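import Mathlib.Analysis.Calculus.Deriv.Polynomial
import Mathlib.Algebra.Polynomial.Derivative
import HarnessLib

/-!
# The terminating hypergeometric polynomials `₂F₁(-n, n+1; c; z)` (Jacobi polynomials)

Topic `Literature/Analysis/SpecialFunctions` (generic special-function algebra; no percolation
content). Motivation and first use: this is the first file of the analytic half of the discharge
of the named fact
`Literature.Probability.Percolation.LawlerSchrammWerner2002_hittingPDE` (`OneArmHittingPDE.lean`;
Lawler–Schramm–Werner, *One-arm exponent for critical 2D percolation*, Electron. J. Probab. 7
(2002), paper no. 2, Lemma 2.2): the step "The theory of diffusion processes and (2.10), (2.11)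
imply that `h(θ, t)` is smooth" (p. 6) is carried out in this tree by an explicit eigenfunction
expansion of the generator `Λ = (κ/2) ∂²_θ + cot(θ/2) ∂_θ` of the radial Bessel process (2.11)
with LSW's boundary behaviour (Dirichlet at `θ = 0`, reflecting at `θ = 2π`). In the variable
`z = sin²(θ/4)` and after splitting off the Dirichlet branch `sin(θ/4)^q`, `q = (κ - 4)/κ`, the
eigenfunctions are the polynomial solutions of Euler's hypergeometric equation
(Andrews–Askey–Roy (2.3.5)) with parameters `a = -n`, `b = n + 1`, `c = 3/2 - 2/κ`:

  `z (1 - z) y'' + (c - 2 z) y' + n (n + 1) y = 0`,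

i.e. `y = ₂F₁(-n, n+1; c; z)`, the Jacobi polynomial `P_n^{(c-1, 1-c)}(1 - 2z)` normalised to
`y(0) = 1` (AAR Def. 2.5.1). This file defines these polynomials by their (terminating)
hypergeometric coefficients and PROVES the differential equation as an identity in `ℝ[X]`
(coefficient comparison: `(k+1)(k+c) a_{k+1} = (k(k+1) - n(n+1)) a_k`) and pointwise.
The `θ`-side (eigenfunctions of `Λ`, LSW's PDE (2.4)) is in
`Literature/Probability/Percolation/OneArmEigenfunctions.lean`; orthogonality on `(0, 1)` is in
`HypergeometricPolynomialOrthogonality.lean`. No named fact is introduced.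

Junk values: the coefficient recursion divides by `(k + 1)(k + c)`; for `c ∈ {0, -1, …, -(n-1)}`
Lean's `x / 0 = 0` silently truncates the polynomial, and the differential equation is stated only
for `k + c ≠ 0` (`k < n`).

## Contents

* `hypJacobiCoeff c n k` — the coefficient `a_k = (-n)_k (n+1)_k / ((c)_k k!)`, by recursion;
  `hypJacobiCoeff_succ_mul` (the recursion in product form), `hypJacobiCoeff_eq_zero_of_lt`.
* `hypJacobi c n : ℝ[X]` — `∑_{k ≤ n} a_k X^k`; `coeff_hypJacobi`, `natDegree_hypJacobi_le`,
  `hypJacobi_eval_zero` (`y(0) = 1`), `hypJacobi_zero` (`n = 0`: the constant `1`).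
* `hypJacobi_ode` — `X (1 - X) y'' + (C c - 2 X) y' + C (n (n+1)) y = 0` in `ℝ[X]` for
  `c ∉ {0, -1, …, -(n-1)}`; `hypJacobi_ode_eval` — the same at every real `z`.

## References

* G. E. Andrews, R. Askey, R. Roy, *Special Functions*, CUP (1999): (2.3.5) (Euler's
  hypergeometric equation), Def. 2.5.1 and (2.5.14) (Jacobi polynomials). [AndrewsAskeyRoy1999]
* G. F. Lawler, O. Schramm, W. Werner, *One-arm exponent for critical 2D percolation*, Electron.
  J. Probab. 7 (2002), no. 2, §2: (2.4), (2.11), Lemma 2.2. [LawlerSchrammWernerEJP2002]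
-/

noncomputable section

open Polynomial

namespace Literature.Analysis.SpecialFunctions

/-! ### The hypergeometric coefficients -/

/-- The coefficient `a_k` of `z^k` in `₂F₁(-n, n+1; c; z) = ∑ a_k z^k`: `a_0 = 1`,
`a_{k+1} = a_k · (-(n - k)(n + k + 1)) / ((k + 1)(k + c))` (so `a_k = 0` for `k > n`).
Junk value: if `k + c = 0` for some `k < n` (i.e. `c ∈ {0, -1, …, -(n-1)}`, excluded in AAR
(2.1.2)) the division by zero returns `0` and the sequence is truncated there.
[cite: AndrewsAskeyRoy1999, (2.1.2) and Def. 2.5.1] -/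
def hypJacobiCoeff (c : ℝ) (n : ℕ) : ℕ → ℝ
  | 0 => 1
  | k + 1 => hypJacobiCoeff c n k *
      (-(((n : ℝ) - k) * ((n : ℝ) + k + 1)) / (((k : ℝ) + 1) * ((k : ℝ) + c)))

/-- `a_0 = 1`. [folklore] -/
@[simp] theorem hypJacobiCoeff_zero (c : ℝ) (n : ℕ) : hypJacobiCoeff c n 0 = 1 := rfl

/-- The defining recursion of the coefficients. [folklore] -/
theorem hypJacobiCoeff_succ (c : ℝ) (n k : ℕ) :
    hypJacobiCoeff c n (k + 1) = hypJacobiCoeff c n k *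
      (-(((n : ℝ) - k) * ((n : ℝ) + k + 1)) / (((k : ℝ) + 1) * ((k : ℝ) + c))) := rfl

/-- `a_{n+1} = 0` (the series terminates). [folklore] -/
theorem hypJacobiCoeff_succ_self (c : ℝ) (n : ℕ) : hypJacobiCoeff c n (n + 1) = 0 := by
  rw [hypJacobiCoeff_succ, sub_self, zero_mul, neg_zero, zero_div, mul_zero]

/-- `a_k = 0` for `k > n`. [folklore] -/
theorem hypJacobiCoeff_eq_zero_of_lt (c : ℝ) {n k : ℕ} (h : n < k) : hypJacobiCoeff c n k = 0 := by
  obtain ⟨j, rfl⟩ := Nat.exists_eq_add_of_lt h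
  induction j with
  | zero => exact hypJacobiCoeff_succ_self c n
  | succ j ih =>
    rw [show n + (j + 1) + 1 = (n + j + 1) + 1 by ring, hypJacobiCoeff_succ,
      ih (by omega), zero_mul]

/-- The recursion in product form: `(k+1)(k+c) a_{k+1} = (k(k+1) - n(n+1)) a_k`, valid when
`k + c ≠ 0`, and trivially (both sides vanish) when `k ≥ n`. [folklore] -/
theorem hypJacobiCoeff_succ_mul {c : ℝ} (n : ℕ) {k : ℕ} (hk : (k : ℝ) + c ≠ 0 ∨ n ≤ k) :
    ((k : ℝ) + 1) * ((k : ℝ) + c) * hypJacobiCoeff c n (k + 1) =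
      ((k : ℝ) * (k + 1) - (n : ℝ) * (n + 1)) * hypJacobiCoeff c n k := by
  rcases hk with hk | hk
  · have hk1 : (k : ℝ) + 1 ≠ 0 := by positivity
    rw [hypJacobiCoeff_succ]
    field_simp
    ring
  · rcases hk.eq_or_lt with rfl | hlt
    · rw [hypJacobiCoeff_succ_self, mul_zero, sub_self, zero_mul]
    · rw [hypJacobiCoeff_eq_zero_of_lt c hlt, hypJacobiCoeff_eq_zero_of_lt c (by omega),
        mul_zero, mul_zero]

/-- The hypothesis "`k + c ≠ 0` for `k < n`" in the form consumed by `hypJacobiCoeff_succ_mul`.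
[folklore] -/
theorem hypJacobiCoeff_hyp {c : ℝ} {n : ℕ} (hc : ∀ k : ℕ, k < n → (k : ℝ) + c ≠ 0) (k : ℕ) :
    (k : ℝ) + c ≠ 0 ∨ n ≤ k := by
  by_cases h : k < n
  · exact Or.inl (hc k h)
  · exact Or.inr (not_lt.1 h)

/-! ### The polynomial `₂F₁(-n, n+1; c; X)` -/

/-- The terminating hypergeometric polynomial `₂F₁(-n, n+1; c; X) = ∑_{k=0}^{n} a_k X^k ∈ ℝ[X]`
(the Jacobi polynomial `P_n^{(c-1,1-c)}(1 - 2X)` normalised to value `1` at `X = 0`).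
[cite: AndrewsAskeyRoy1999, Def. 2.5.1] -/
def hypJacobi (c : ℝ) (n : ℕ) : ℝ[X] :=
  ∑ k ∈ Finset.range (n + 1), C (hypJacobiCoeff c n k) * X ^ k

/-- The coefficients of `hypJacobi c n` are the `a_k` (for every `k`). [folklore] -/
theorem coeff_hypJacobi (c : ℝ) (n k : ℕ) : (hypJacobi c n).coeff k = hypJacobiCoeff c n k := by
  rw [hypJacobi, finsetSum_coeff]
  simp only [coeff_C_mul_X_pow]
  rw [Finset.sum_ite_eq]
  split_ifs with h
  · rfl
  · rw [Finset.mem_range, not_lt] at h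
    exact (hypJacobiCoeff_eq_zero_of_lt c (Nat.lt_of_succ_le h)).symm

/-- `deg ₂F₁(-n, n+1; c; X) ≤ n`. [folklore] -/
theorem natDegree_hypJacobi_le (c : ℝ) (n : ℕ) : (hypJacobi c n).natDegree ≤ n := by
  rw [natDegree_le_iff_coeff_eq_zero]
  intro k hk
  rw [coeff_hypJacobi]
  exact hypJacobiCoeff_eq_zero_of_lt c (by exact_mod_cast hk)

/-- `₂F₁(-n, n+1; c; 0) = 1`. [folklore] -/
theorem hypJacobi_eval_zero (c : ℝ) (n : ℕ) : (hypJacobi c n).eval 0 = 1 := by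
  rw [← coeff_zero_eq_eval_zero, coeff_hypJacobi, hypJacobiCoeff_zero]

/-- For `n = 0` the polynomial is the constant `1`. [folklore] -/
theorem hypJacobi_zero (c : ℝ) : hypJacobi c 0 = 1 := by
  simp [hypJacobi]

/-- `₂F₁(0, 1; c; z) = 1`. [folklore] -/
@[simp] theorem hypJacobi_zero_eval (c z : ℝ) : (hypJacobi c 0).eval z = 1 := by
  rw [hypJacobi_zero, eval_one]

/-! ### Euler's hypergeometric differential equation -/

section ODE

variable {c : ℝ} (n : ℕ)

/-- Coefficients of the first derivative: `(y').coeff k = (k+1) a_{k+1}`. [folklore] -/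
theorem coeff_derivative_hypJacobi (c : ℝ) (n k : ℕ) :
    (derivative (hypJacobi c n)).coeff k = hypJacobiCoeff c n (k + 1) * ((k : ℝ) + 1) := by
  rw [coeff_derivative, coeff_hypJacobi]

/-- Coefficients of the second derivative: `(y'').coeff k = (k+1)(k+2) a_{k+2}`. [folklore] -/
theorem coeff_derivative_derivative_hypJacobi (c : ℝ) (n k : ℕ) :
    (derivative (derivative (hypJacobi c n))).coeff k =
      hypJacobiCoeff c n (k + 2) * ((k : ℝ) + 2) * ((k : ℝ) + 1) := by
  rw [coeff_derivative, coeff_derivative_hypJacobi]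
  push_cast
  ring

/-- **Euler's hypergeometric equation for `₂F₁(-n, n+1; c; X)`** (AAR (2.3.5) with `a = -n`,
`b = n + 1`, so `a + b + 1 = 2`, `-ab = n(n+1)`), as an identity in `ℝ[X]`, in expanded form:
`X y'' - X² y'' + c y' - 2 X y' + n(n+1) y = 0`, for `c ∉ {0, -1, …, -(n-1)}`. Proof: the
coefficient of `X^k` is `(k+1)(k+c) a_{k+1} + (n(n+1) - k(k+1)) a_k = 0` by the recursion.
[cite: AndrewsAskeyRoy1999, (2.3.5)] -/
theorem hypJacobi_ode' (hc : ∀ k : ℕ, k < n → (k : ℝ) + c ≠ 0) :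
    X * derivative (derivative (hypJacobi c n)) - X ^ 2 * derivative (derivative (hypJacobi c n))
      + C c * derivative (hypJacobi c n) - 2 * (X * derivative (hypJacobi c n))
      + C ((n : ℝ) * (n + 1)) * hypJacobi c n = 0 := by
  ext k
  have hrec := fun j : ℕ => hypJacobiCoeff_succ_mul (c := c) n (hypJacobiCoeff_hyp hc j)
  rcases k with _ | _ | j
  · simp only [coeff_add, coeff_sub, coeff_X_mul_zero, mul_comm (X ^ 2 : ℝ[X]),
      coeff_mul_X_pow', coeff_C_mul, coeff_ofNat_mul, coeff_derivative_hypJacobi,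
      coeff_hypJacobi, coeff_zero]
    have h0 := hrec 0
    push_cast at h0 ⊢
    simp only [zero_add] at h0 ⊢
    linear_combination h0
  · simp only [coeff_add, coeff_sub, coeff_X_mul, mul_comm (X ^ 2 : ℝ[X]),
      coeff_mul_X_pow', coeff_C_mul, coeff_ofNat_mul, coeff_derivative_hypJacobi,
      coeff_derivative_derivative_hypJacobi, coeff_hypJacobi, coeff_zero, zero_add]
    have h1 := hrec 1
    push_cast at h1 ⊢
    norm_num at h1 ⊢
    linear_combination h1
  · simp only [coeff_add, coeff_sub, coeff_X_mul, mul_comm (X ^ 2 : ℝ[X]),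
      coeff_mul_X_pow', coeff_C_mul, coeff_ofNat_mul, coeff_derivative_hypJacobi,
      coeff_derivative_derivative_hypJacobi, coeff_hypJacobi, coeff_zero]
    have h2 := hrec (j + 2)
    simp only [show 2 ≤ j + 1 + 1 from by omega, if_true, show j + 1 + 1 - 2 = j from by omega]
    push_cast at h2 ⊢
    linear_combination h2

/-- **Euler's hypergeometric equation for `₂F₁(-n, n+1; c; X)`** in the factored form
`X (1 - X) y'' + (c - 2X) y' + n(n+1) y = 0` in `ℝ[X]` (`c ∉ {0, -1, …, -(n-1)}`).
[cite: AndrewsAskeyRoy1999, (2.3.5)] -/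
theorem hypJacobi_ode (hc : ∀ k : ℕ, k < n → (k : ℝ) + c ≠ 0) :
    X * (1 - X) * derivative (derivative (hypJacobi c n))
      + (C c - 2 * X) * derivative (hypJacobi c n)
      + C ((n : ℝ) * (n + 1)) * hypJacobi c n = 0 := by
  rw [← hypJacobi_ode' n hc]
  ring

/-- **Euler's hypergeometric equation, pointwise**: for every real `z`,
`z (1 - z) y''(z) + (c - 2 z) y'(z) + n (n + 1) y(z) = 0` for `y = ₂F₁(-n, n+1; c; ·)`
(`c ∉ {0, -1, …, -(n-1)}`). [cite: AndrewsAskeyRoy1999, (2.3.5)] -/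
theorem hypJacobi_ode_eval (hc : ∀ k : ℕ, k < n → (k : ℝ) + c ≠ 0) (z : ℝ) :
    z * (1 - z) * (derivative (derivative (hypJacobi c n))).eval z
      + (c - 2 * z) * (derivative (hypJacobi c n)).eval z
      + (n : ℝ) * (n + 1) * (hypJacobi c n).eval z = 0 := by
  have h := congrArg (eval z) (hypJacobi_ode n hc)
  simpa only [eval_add, eval_mul, eval_sub, eval_X, eval_C, eval_one, eval_ofNat,
    eval_zero] using h

end ODE

/-! ### Calculus of `z ↦ y(z)` -/

/-- The polynomial function `z ↦ ₂F₁(-n, n+1; c; z)` has derivative `y'(z)`. [folklore] -/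
theorem hasDerivAt_hypJacobi_eval (c : ℝ) (n : ℕ) (z : ℝ) :
    HasDerivAt (fun x => (hypJacobi c n).eval x) ((derivative (hypJacobi c n)).eval z) z :=
  Polynomial.hasDerivAt _ z

/-- … and `y'` has derivative `y''`. [folklore] -/
theorem hasDerivAt_derivative_hypJacobi_eval (c : ℝ) (n : ℕ) (z : ℝ) :
    HasDerivAt (fun x => (derivative (hypJacobi c n)).eval x)
      ((derivative (derivative (hypJacobi c n))).eval z) z :=
  Polynomial.hasDerivAt _ z

/-- Polynomial functions are continuous (recorded for the eigenfunction files). [folklore] -/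
theorem continuous_hypJacobi_eval (c : ℝ) (n : ℕ) :
    Continuous fun x => (hypJacobi c n).eval x :=
  (Polynomial.differentiable _).continuous

/-- A real polynomial is bounded on `[0, 1]`: there is `M ≥ 0` with `|p(z)| ≤ M` for
`z ∈ [0, 1]` (recorded for the boundary behaviour of the eigenfunctions). [folklore] -/
theorem exists_bound_polynomial_eval_unitInterval (p : ℝ[X]) :
    ∃ M : ℝ, 0 ≤ M ∧ ∀ z ∈ Set.Icc (0 : ℝ) 1, |p.eval z| ≤ M := by
  obtain ⟨M, hM⟩ := (isCompact_Icc (a := (0 : ℝ)) (b := 1)).exists_bound_of_continuousOn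
    (f := fun x => p.eval x) (Polynomial.differentiable p).continuous.continuousOn
  refine ⟨max M 0, le_max_right _ _, fun z hz => (le_max_left _ _).trans' ?_⟩
  have := hM z hz
  rwa [Real.norm_eq_abs] at this

end Literature.Analysis.SpecialFunctions
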